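import Mathlib
import Summits.HodgeConjecture.HodgeConjecture.Theses.HeckePrymWeil
import Literature.AlgebraicGeometry.HodgeTheory.CorrespondenceAction

/-!
# Sketch — crux-ideate r1, ideator k = 3 (gen 2), crux `WeilSixfoldsSqrtMinus7` (stmt-HodgeConjecture-1260)

First-lemma signatures for the crux idea **`bloch-ladder-det-projector`**
("prove vanishing, get the cycle": the Bloch–Srinivas–Paranjape–Laterveer–Vial ladder run on the
canonical Chow projector `π_W` onto the `K`-isotypic piece `h^{(6,0)} ⊕ h^{(0,6)} ⊂ h⁶(A)`).

THE LINE, informally (card §Lever/§Transfer). Let `(A, φ)` be a `ℚ(√-7)`-Weil sixfold, `α = (1+φ)/2`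
(`αᾱ = 2`), `W ⊂ H⁶(A, ℚ)` the Weil plane. O'Sullivan's theorem (symmetrically distinguished
cycles `DCH(A×A) ≅` numerical classes, a `ℚ`-subalgebra stable under pull/push along homomorphisms;
O'Sullivan 2011 Thm 6.2.5 = Fu–Vial arXiv:1709.05644 Thm 1.8; built on Kimura finite-dimensionality)
gives a UNIQUE distinguished lift `π_W ∈ DCH⁶(A × A)` of the homological Weil projector
`P(α^*) ∘ π⁶` — automatically a SELF-ADJOINT CHOW IDEMPOTENT (= `π^{(6,0)} + π^{(0,6)}` of Moonen's
refined Chow–Künneth decomposition), whose cohomological realization is the orthogonal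
projector onto `W` (on `H⁶` it is `P(α^*)` with `α^*|_W` annihilated by `t² - 9t + 64`, cf.
`alphaPowSix`, `alphaPowSix_minpoly`; this is Disproof.lean's `mem_weilPlane_iff` divided by `64`).
LADDER THEOREM (Voisin II Thm 10.29 / Rem 10.30 for the correspondence `π_W = π_W^t`): IF
  (V₀) `(π_W)_* CH₀(A_L)_ℚ = 0`, (V₁) `(π_W)_* CH₁(A_L)_ℚ = 0`, (V₂) `(π_W)_* CH₂(A_L)_ℚ = 0`
for every algebraically closed field `L ⊇ ℂ`, THEN `π_W` is rationally equivalent to a cycle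
supported in `T × A` with `codim T ≥ 3`, hence (this file, `weil_of_projectorSupportedInCodim`)
`W ⊂ N³H⁶(A(ℂ); ℂ) = algebraicClasses A.X 3` — the crux. Conversely HC(W) ⇒ (V₀)∧(V₁)∧(V₂)
(`π_W = Σ λ_ij Zᵢ × Z'ⱼ + nilpotent`, Kimura), so the package is EQUIVALENT to the crux, per `A`.
Partial credit: (V₀) alone ⇒ `W ⊂ N¹H⁶` (= crux X1 `NodalThetaSupport` of route NodalThetaWeil,
`weil_coniveauOne_of_projectorSupportedInCodimOne`); (V₀)∧(V₁) ⇒ `W ⊂ N²H⁶`.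
(V₀) unpacked (Beauville decomposition, `γ₁(p) = log (p)`, `*` = Pontryagin product):
  `∀ p ∈ A(L):  (γ₁(αp) - σ̄(α)·γ₁(p))^{*6} = 0`  in `CH₀(A_L) ⊗ ℚ̄`,
equivalently `Σ_{k=0}^{6} (-σ̄(α))^{6-k} γ_k(αp) * γ_{6-k}(p) = 0`: "a point of a (3,3) Weil sixfold
has no sixth σ-power". Its Mumford invariant vanishes to order 3 BECAUSE the signature is (3,3)
(`mumfordWeight_eval_eq_zero`; for the (6,0) CM witness `E⁶` of Disproof.lean it does not vanish and
(V₀) is false there — the line uses `IsOfHodgeType 6 A.X 6 3 3` exactly at rung 0).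
PROVED INSTANCES of (V₀) (card §Why it bites, by hand): every `X ⊗_ℤ O_K` (`X` ANY abelian
threefold, `α ↦ [[0,-2],[1,1]]`; 3 lines: the σ-eigen log-point is `-2γ₁(x)⊠0 + σ(α)·0⊠γ₁(x)`, its
sixth power is `20·(-2σ(α))³ γ₁(x)^{*3} ⊠ γ₁(x)^{*3} = c·γ₆^{X²}((x,x)) = c·Δ_*γ₆^X(x) = 0` since
`CH³_6(X) = 0` on a threefold (Beauville) — polarization over the group `X(L)` finishes); and
`E³_σ × E³_σ̄` (all polarizations, all discriminants) by the balance lemma `s(ua,b) = s(a,ub)` in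
`T(E×E)_ℚ` (from `Sym²E` ruled over `E`).

Nothing here proves the crux; `sorry` appears only in the body of the pure-algebra lifting lemma.
-/

noncomputable section

namespace Summit.HodgeConjecture.HodgeConjecture.Cruxes.WeilSixfoldsSqrtMinus7.IdeatorThreeG2

open CategoryTheory AlgebraicGeometry MonoidalCategory Complex
open Literature.AlgebraicGeometry Literature.AlgebraicGeometry.HodgeTheory

/-! ## §1 The Weil plane and the last rung of the ladder (real carriers) -/

/-- The complexified Weil plane of `(A, φ)`, typed exactly as in the crux: the sum of the two
eigenspaces of `(𝟙 + φ)^*` on `H⁶(A(ℂ); ℂ)` for `(1 ± i√7)⁶`. -/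
def WeilPlane (A : Motives.AbelianVariety ℂ) (φ : A ⟶ A) : Submodule ℂ (complexBetti A.X 6) :=
  Module.End.eigenspace (complexBetti.map (CategoryStruct.id A + φ).hom.hom.hom 6).hom
      ((1 + I * (Real.sqrt (7 : ℝ) : ℂ)) ^ 6) ⊔
    Module.End.eigenspace (complexBetti.map (CategoryStruct.id A + φ).hom.hom.hom 6).hom
      ((1 - I * (Real.sqrt (7 : ℝ) : ℂ)) ^ 6)

/-- **Last rung (typed, proved).** If some `6`-cycle `Γ` on `A × A` (think: a representative of the
Chow projector `π_W` after the ladder has pushed its support into codimension `3`) is supported in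
`T × A` with `T` Zariski-closed of codimension `≥ 3`, and acts as the identity on the Weil plane
(`[Γ]^*|_W = id`, which is what "realization of `π_W` = proj_W" says), then every Weil class is an
algebraic class in the crux's sense `algebraicClasses A.X 3 = N³H⁶`. Uses only the tree's
`CorrespondenceAction.act_mem_supportedClasses` (Voisin II (10.8)). -/
theorem weil_of_projectorSupportedInCodim
    {A : Motives.AbelianVariety ℂ} (φ : A ⟶ A) (C : CorrespondenceAction 6 A.X)
    (Γ : ↥(Motives.cyclesOfDim (A.X ⊗ A.X).left 6))
    {T : Set A.X.left} (hT : IsClosed T) (h3 : ∀ z ∈ T, (3 : ℕ∞) ≤ Order.coheight z)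
    (hsupp : ∀ z, (Γ : AlgebraicCycle (A.X ⊗ A.X).left ℤ) z ≠ 0 →
      (CartesianMonoidalCategory.fst A.X A.X).left.base z ∈ T)
    (hid : ∀ c ∈ WeilPlane A φ, C.act 6 Γ c = c) :
    ∀ c ∈ WeilPlane A φ, c ∈ algebraicClasses A.X 3 := by
  intro c hc
  rw [← hid c hc]
  exact C.act_mem_supportedClasses 6 hT h3 hsupp c

/-- **Rung-0 payoff (typed, proved): coniveau one.** Same with codimension `≥ 1` (what (V₀) alone
delivers through the `k₀ = 0` decomposition): the Weil classes are supported on a divisor,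
`W ⊂ N¹H⁶` — the coniveau-`≥ 1` form of crux X1 `NodalThetaSupport` of route NodalThetaWeil. -/
theorem weil_coniveauOne_of_projectorSupportedInCodimOne
    {A : Motives.AbelianVariety ℂ} (φ : A ⟶ A) (C : CorrespondenceAction 6 A.X)
    (Γ : ↥(Motives.cyclesOfDim (A.X ⊗ A.X).left 6))
    {D : Set A.X.left} (hD : IsClosed D) (h1 : ∀ z ∈ D, (1 : ℕ∞) ≤ Order.coheight z)
    (hsupp : ∀ z, (Γ : AlgebraicCycle (A.X ⊗ A.X).left ℤ) z ≠ 0 →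
      (CartesianMonoidalCategory.fst A.X A.X).left.base z ∈ D)
    (hid : ∀ c ∈ WeilPlane A φ, C.act 6 Γ c = c) :
    ∀ c ∈ WeilPlane A φ, c ∈ supportedClasses A.X 6 1 := by
  intro c hc
  rw [← hid c hc]
  exact C.act_mem_supportedClasses 6 hD h1 hsupp c

/-- **The line concludes the crux BY NAME.** The ladder's output, stated per `(A, φ)` as the
existence of a cohomological correspondence action together with a codimension-`3`-supported
cycle acting as the identity on the Weil plane, implies `WeilSixfoldsSqrtMinus7` (the hypotheses
`IsRationalClass`, `IsOfHodgeType` of the crux are not even needed at this last step — they were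
consumed upstream: (3,3) at rung 0, rationality nowhere, cf. Disproof.lean §4). -/
theorem crux_of_supportedProjectors
    (H : ∀ (A : Motives.AbelianVariety ℂ) (φ : A ⟶ A), A.dim = 6 →
      CategoryStruct.comp φ φ = -((7 : ℤ) • CategoryStruct.id A) →
      ∃ (C : CorrespondenceAction 6 A.X) (Γ : ↥(Motives.cyclesOfDim (A.X ⊗ A.X).left 6))
        (T : Set A.X.left), IsClosed T ∧ (∀ z ∈ T, (3 : ℕ∞) ≤ Order.coheight z) ∧
        (∀ z, (Γ : AlgebraicCycle (A.X ⊗ A.X).left ℤ) z ≠ 0 →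
          (CartesianMonoidalCategory.fst A.X A.X).left.base z ∈ T) ∧
        (∀ c ∈ WeilPlane A φ, C.act 6 Γ c = c)) :
    Theses.HeckePrymWeil.WeilSixfoldsSqrtMinus7 := by
  intro A φ hdim hφ c _hrat _hhodge heig
  obtain ⟨C, Γ, T, hT, h3, hsupp, hid⟩ := H A φ hdim hφ
  exact weil_of_projectorSupportedInCodim φ C Γ hT h3 hsupp hid c heig

/-! ## §2 The explicit projector: arithmetic of `α = (1 + √-7)/2` on the Weil plane -/

/-- `(i√7)² = -7`. -/
theorem I_mul_sqrt7_sq : (I * (Real.sqrt (7 : ℝ) : ℂ)) ^ 2 = -7 := by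
  rw [mul_pow, Complex.I_sq, ← Complex.ofReal_pow, Real.sq_sqrt (by norm_num : (0 : ℝ) ≤ 7)]
  push_cast
  ring

/-- `(1 + t)⁶ = 288 + 160 t` for `t = i√7` (Disproof.lean `weilEigenvalue_values`, reproved so that
this sketch does not import the crux work-file). -/
theorem one_add_pow_six : (1 + I * (Real.sqrt (7 : ℝ) : ℂ)) ^ 6 = 288 + 160 * (I * (Real.sqrt (7 : ℝ) : ℂ)) := by
  have h7 := I_mul_sqrt7_sq
  set t : ℂ := I * (Real.sqrt (7 : ℝ) : ℂ) with ht
  linear_combination (t ^ 4 + 6 * t ^ 3 + 8 * t ^ 2 - 22 * t - 41) * h7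

/-- **`σ(α)⁶ = (9 + 5√-7)/2`**: the eigenvalue of `α^*` on the Weil line `∧⁶V_σ`
(`α = (1+√-7)/2`, norm `2`; `|σ(α)⁶|² = (81 + 175)/4 = 64 = 2⁶`). -/
theorem alphaPowSix :
    ((1 + I * (Real.sqrt (7 : ℝ) : ℂ)) / 2) ^ 6 = (9 + 5 * (I * (Real.sqrt (7 : ℝ) : ℂ))) / 2 := by
  rw [div_pow, one_add_pow_six]
  ring

/-- **The Weil plane is `ker(m_W(α^*))` with `m_W(t) = t² - 9t + 64`** (both eigenvalues
`σ(α)⁶, σ̄(α)⁶` are roots; `m_W` is irreducible over `ℚ`, disc `81 - 256 = -175`): so the homological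
Weil projector is an explicit `ℚ`-polynomial in `α^*|_{H⁶}` — divide Disproof.lean's
`T² - 576T + 8⁶` for `T = (2α)^* = 64 α^*` by `64²`. -/
theorem alphaPowSix_minpoly :
    (((1 + I * (Real.sqrt (7 : ℝ) : ℂ)) / 2) ^ 6) ^ 2 - 9 * ((1 + I * (Real.sqrt (7 : ℝ) : ℂ)) / 2) ^ 6 + 64 = 0 := by
  have h7 := I_mul_sqrt7_sq
  rw [alphaPowSix]
  set t : ℂ := I * (Real.sqrt (7 : ℝ) : ℂ) with ht
  linear_combination (25 / 4 : ℂ) * h7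

/-! ## §3 Why (V₀) is consistent with Mumford exactly in signature (3,3)

The family `p ↦ Σ_b (-σ̄α)^{6-b} M_{6-b,b}(p)` of `0`-cycles in (V₀) pulls back the `(6,0)`-form of
`A` with weight `Σ_b e_b(S)·(-σ̄α)^{6-b} = ∏_{λ ∈ S} (λ - σ̄α)`, where `S` is the multiset of
eigenvalues of `α^*` on `H^{1,0}`: three copies of `s = σ(α)` and three of `s̄ = σ̄(α)` for Weil type
(3,3). The weight is the evaluation at `-s̄` of `(X + s)³(X + s̄)³`, which vanishes (triple root);
for the Disproof's (6,0) witness `E⁶` it would be `(s - s̄)⁶ = (√-7)⁶ ≠ 0`, and there (V₀) fails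
(Mumford), matching `weilSixfolds_withoutHodgeType_false_of_witness`. -/

/-- The Mumford weight of the (V₀)-family vanishes in signature (3,3): evaluation of
`(X + C s)³ (X + C s')³` at `-s'` is zero, for any `s s'` (here `s = σ(α)`, `s' = σ̄(α)`). -/
theorem mumfordWeight_eval_eq_zero (s s' : ℂ) :
    Polynomial.eval (-s') ((Polynomial.X + Polynomial.C s) ^ 3 * (Polynomial.X + Polynomial.C s') ^ 3) = 0 := by
  simp

/-- … whereas in signature (6,0) the weight is `(s - s')⁶`, non-zero as soon as `s ≠ s'`. -/
theorem mumfordWeight_eval_ne_zero_of_sixZero {s s' : ℂ} (h : s ≠ s') :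
    Polynomial.eval (-s') ((Polynomial.X + Polynomial.C s) ^ 6) ≠ 0 := by
  simp only [Polynomial.eval_pow, Polynomial.eval_add, Polynomial.eval_X, Polynomial.eval_C]
  exact pow_ne_zero 6 (by
    intro h0
    apply h
    linear_combination h0)

/-! ## §4 The pure-algebra input: self-adjoint idempotent lifting through a nilpotent ideal

Used to turn the homological Weil projector (self-adjoint, since `W` is Poincaré-self-dual and the
`K`-isotypic decomposition is orthogonal) into a SELF-ADJOINT CHOW idempotent `π_W = π_W^t`:
`End_{CH}(h⁶(A)) → End_{hom}(H⁶(A))` has nilpotent kernel (Kimura 2005, abelian varieties are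
finite-dimensional; Lieberman: hom = num on abelian varieties), transposition is an anti-involution
preserving the kernel, and `2` is invertible. Proof idea: `h := (e + e⋆)/2` is self-adjoint and
idempotent mod `N`; the idempotent-lifting iteration `h ↦ 3h² - 2h³` stays inside the commutative,
`⋆`-fixed subalgebra `ℚ[h]` and stabilises because `N` is nilpotent. -/

/-- Self-adjoint idempotent lifting (statement over an abstract `ℚ`-algebra with an
anti-involution; body `sorry` — M-sized algebra, cf. Mathlib's
`CompleteOrthogonalIdempotents.lift_of_isNilpotent_ker` for the non-`⋆` version). -/
theorem exists_selfAdjoint_idempotent_lift {R : Type*} [Ring R] [Algebra ℚ R] [StarRing R]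
    (N : Ideal R) (hN : ∃ n : ℕ, N ^ n = ⊥) (hNstar : ∀ x ∈ N, star x ∈ N)
    (e : R) (he : e * e - e ∈ N) (hes : star e - e ∈ N) :
    ∃ f : R, f * f = f ∧ star f = f ∧ f - e ∈ N := by
  sorry

end Summit.HodgeConjecture.HodgeConjecture.Cruxes.WeilSixfoldsSqrtMinus7.IdeatorThreeG2

end
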